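import Summits.CriticalPhenomena.PercolationContinuityZ3.Theorems.PercNearOneGluingNoHeavyQuantFarHubFamilyReach
import Summits.CriticalPhenomena.PercolationContinuityZ3.Theorems.PercNearOneGluingNoHeavyQuantFarTwoHubLaw
import Summits.CriticalPhenomena.PercolationContinuityZ3.Theorems.PercNearOneGluingNoHeavyQuantFarTwoAnchorBlock
import Summits.CriticalPhenomena.PercolationContinuityZ3.Theorems.PercNearOneGluingNoHeavyQuantFarHairyCycleReach
import HarnessLib

/-!
# QUANT lane R8, front "FAR beyond trees", layer one — PENDANT CYCLE BLOCKS I: the data, almost-sure goodness, and the ARC READING of the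
# block count (`X = Σ_j 𝟙[arc to c_j open]·W_j` almost surely)

builds on p205010 (kernel theorem, internal audit signed; external expert review pending)

Support file (`--supports stmt-CriticalPhenomena-4575`), seat `prim-quant-p1` (gen 22); memo
`run/shared/lean/prim/quant/prim-quant-p1-g22/FOR-LEAD-KHUB.md` §1–§2 (the k-hub graph transfer of p1 g21's memo `FOR-LEAD-CYCDEC.md` §6(5)).
Standard axioms; no sorries.

THE BLOCK (`Block.IsCycleBlock L cyc S Z`): an injective cycle `c = cyc 0, cyc 1, …, cyc (L−1)` (`L ≥ 3`) through the cut vertex `c`; at every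
cycle vertex `cyc j`, `1 ≤ j < L`, hangs a hub `S j` (ANY vertex set — a pendant sub-cactus, hairs, or `∅`); `Z` = the cycle vertices other than
`c` together with the hubs.  THE WEIGHTS (`Block.CycleHang L cyc S Z w`): `w` hangs `Z` at `c`, hangs `S j` at `cyc j`, and kills the chords of the
cycle.  Then almost surely (`Block.real_congr_cycle`; the exceptional pairs `Block.cycleForb` all carry weight `0`) the configuration is good for the
block and for every hub and the open core pairs are cycle edges (`Block.CycleGood`), so that — with `…QuantFarHubFamilyReach` and prim-cert-1's
arc reading `HairyCycle.mem_openConn_cyc_iff` —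
* `Block.coreReach_iff_RC` — `c ↔ cyc j` through the core iff the clockwise arc `e_0 … e_{j−1}` or the counter-clockwise arc `e_j … e_{L−1}` is open;
* **`Block.card_on_eq_arcCount`** — `#{a ∈ A ∩ Z : c ↔ a on Z} = Block.arcCount … ω := Σ_{1 ≤ j < L} 𝟙[RC ω j]·W_j(ω)`,
  `W_j = Block.hubCount … j ω = #{a ∈ A ∩ S j : cyc j ↔ a inside S j ∪ {cyc j}} + 𝟙[cyc j ∈ A]`;
* `Block.real_card_on_eq_arcCount` — hence every event read off the block count has the probability of the same event read off `arcCount`.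
From here on the k-hub transfer is a computation with arcs and independent hub counts (`…QuantFarCycleBlockChain/Law*`).
[cite: Grimmett1999, §1.3 p. 10] (open paths, product measure); bookkeeping [this work].
-/

noncomputable section

namespace Summit.CriticalPhenomena.PercolationContinuityZ3.Theorems

namespace Quant

namespace Block

open Finset MeasureTheory Set
open Literature.Probability.LatticeModels
open Literature.Probability.Percolation
open Summit.CriticalPhenomena.PercolationContinuityZ3.Theorems.HairyCycle (cycE CW CCW RC Carried cycE_eq_iff mem_openConn_cyc_iff)
open Bundle (offZ avoid)
open scoped Classical

variable {n : ℕ}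

/-! ## The data of a pendant cycle block with hubs -/

/-- A PENDANT CYCLE BLOCK WITH HUBS: an injective cycle `cyc 0 = c, cyc 1, …, cyc (L−1)` (`L ≥ 3`) through the cut vertex `c ∉ Z`; at each
cycle vertex `cyc j` (`1 ≤ j < L`) a hub `S j ⊆ Z` (pairwise disjoint, off the cycle); `Z` consists of these cycle vertices and hubs. [this work] -/
structure IsCycleBlock (L : ℕ) (cyc : ℕ → Fin n) (S : ℕ → Finset (Fin n)) (Z : Finset (Fin n)) : Prop where
  hL : 3 ≤ L
  hcyc : ∀ i j, i < L → j < L → cyc i = cyc j → i = j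
  cZ : cyc 0 ∉ Z
  cycZ : ∀ j, 1 ≤ j → j < L → cyc j ∈ Z
  SZ : ∀ j, 1 ≤ j → j < L → S j ⊆ Z
  cycS : ∀ i j, i < L → 1 ≤ j → j < L → cyc i ∉ S j
  disj : ∀ i j, 1 ≤ i → i < L → 1 ≤ j → j < L → i ≠ j → Disjoint (S i) (S j)
  Zsub : ∀ x ∈ Z, ∃ j, 1 ≤ j ∧ j < L ∧ (x = cyc j ∨ x ∈ S j)

/-- The weights of a pendant cycle block: `w` hangs `Z` at `c = cyc 0`, hangs each hub `S j` at `cyc j`, and vanishes on the chords of the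
cycle. [this work] -/
structure CycleHang (L : ℕ) (cyc : ℕ → Fin n) (S : ℕ → Finset (Fin n)) (Z : Finset (Fin n)) (w : Sym2 (Fin n) → unitInterval) : Prop where
  hangZ : ∀ x y : Fin n, x ≠ y → x ∈ Z → y ∉ Z → y ≠ cyc 0 → (w s(x, y) : ℝ) = 0
  hangS : ∀ j, 1 ≤ j → j < L → ∀ x y : Fin n, x ≠ y → x ∈ S j → y ∉ S j → y ≠ cyc j → (w s(x, y) : ℝ) = 0
  chord : ∀ i j, i < L → j < L → i ≠ j → (i + 1) % L ≠ j → (j + 1) % L ≠ i → (w s(cyc i, cyc j) : ℝ) = 0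

/-- The hub positions `1, …, L−1`. [this work] -/
def cpos (L : ℕ) : Finset ℕ := Finset.Ico 1 L

/-- Membership in `cpos`. [this work] -/
theorem mem_cpos {L j : ℕ} : j ∈ cpos L ↔ 1 ≤ j ∧ j < L := Finset.mem_Ico

/-- The LOADED COUNT of hub `j`: relays of `S j` joined to `cyc j` inside `S j ∪ {cyc j}`, plus one if the anchor itself is a relay. [this work] -/
def hubCount (cyc : ℕ → Fin n) (S : ℕ → Finset (Fin n)) (A : Finset (Fin n)) (j : ℕ) (ω : BondConfig (Fin n)) : ℕ :=
  ((A ∩ S j).filter fun a => inS (S j) (cyc j) ω ∈ openConn (cyc j) a).card + (if cyc j ∈ A then 1 else 0)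

/-- The ARC READING of the block count: `Σ_{1 ≤ j < L} 𝟙[RC ω j]·W_j(ω)` (`RC ω j`: an arc from `c` to `cyc j` is open). [this work] -/
def arcCount (L : ℕ) (cyc : ℕ → Fin n) (S : ℕ → Finset (Fin n)) (A : Finset (Fin n)) (ω : BondConfig (Fin n)) : ℕ :=
  ∑ j ∈ cpos L, if RC L cyc ω j then hubCount cyc S A j ω else 0

section CycleBlock

variable {L : ℕ} {cyc : ℕ → Fin n} {S : ℕ → Finset (Fin n)} {Z : Finset (Fin n)} (H : IsCycleBlock L cyc S Z)
include H

/-- A pendant cycle block with hubs is a hub family on the positions `1, …, L−1`. [this work] -/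
theorem isHubFamily : IsHubFamily (cyc 0) Z (cpos L) cyc S where
  cZ := H.cZ
  SZ j hj := H.SZ j (mem_cpos.1 hj).1 (mem_cpos.1 hj).2
  vZ j hj := H.cycZ j (mem_cpos.1 hj).1 (mem_cpos.1 hj).2
  vS i hi j hj := H.cycS i j (mem_cpos.1 hi).2 (mem_cpos.1 hj).1 (mem_cpos.1 hj).2
  vinj i hi j hj h := H.hcyc i j (mem_cpos.1 hi).2 (mem_cpos.1 hj).2 h
  disj i hi j hj hij := H.disj i j (mem_cpos.1 hi).1 (mem_cpos.1 hi).2 (mem_cpos.1 hj).1 (mem_cpos.1 hj).2 hij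

/-- The vertices of the cycle edge `e_m` are cycle vertices. [this work] -/
theorem mem_cycE {m : ℕ} (hm : m < L) {y : Fin n} (hy : y ∈ cycE L cyc m) : ∃ i, i < L ∧ y = cyc i := by
  have hL := H.hL
  unfold cycE at hy
  rcases Sym2.mem_iff.1 hy with rfl | rfl
  · exact ⟨m, hm, rfl⟩
  · exact ⟨(m + 1) % L, Nat.mod_lt _ (by omega), rfl⟩

/-- A cycle vertex lies in no hub. [this work] -/
theorem cyc_notMem_hubs {i : ℕ} (hi : i < L) : cyc i ∉ hubs (cpos L) S := by
  intro h
  obtain ⟨j, hj, hij⟩ := mem_hubs.1 h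
  exact H.cycS i j hi (mem_cpos.1 hj).1 (mem_cpos.1 hj).2 hij

/-- A cycle edge meets `Z` and avoids the hubs; hence it is open in the core iff it is open. [this work] -/
theorem cycE_mem_core_iff {m : ℕ} (hm : m < L) (ω : BondConfig (Fin n)) :
    cycE L cyc m ∈ core Z (hubs (cpos L) S) ω ↔ cycE L cyc m ∈ ω := by
  have hL := H.hL
  refine ⟨fun h => h.1, fun h => ⟨h, ?_, fun ℓ hℓ hmem => ?_⟩⟩
  · -- an endpoint in `Z`: `cyc (m+1 mod L)` unless that is `c`, in which case `cyc m`
    by_cases h0 : (m + 1) % L = 0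
    · have hm1 : 1 ≤ m := by
        by_contra hlt
        have : m = 0 := by omega
        subst this
        rw [Nat.mod_eq_of_lt (by omega : 0 + 1 < L)] at h0
        exact absurd h0 (by omega)
      exact ⟨cyc m, H.cycZ m hm1 hm, by unfold cycE; exact Sym2.mem_mk_left _ _⟩
    · exact ⟨cyc ((m + 1) % L), H.cycZ _ (Nat.one_le_iff_ne_zero.2 h0) (Nat.mod_lt _ (by omega)),
        by unfold cycE; exact Sym2.mem_mk_right _ _⟩
  · obtain ⟨i, hi, rfl⟩ := mem_cycE H hm hmem
    exact cyc_notMem_hubs H hi hℓ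

/-- The arc events read off the core agree with those read off the configuration. [this work] -/
theorem RC_core_iff {j : ℕ} (hj : j ≤ L) (ω : BondConfig (Fin n)) :
    RC L cyc (core Z (hubs (cpos L) S) ω) j ↔ RC L cyc ω j := by
  unfold RC CW CCW
  constructor
  · rintro (h | h)
    · exact Or.inl fun m hm => (cycE_mem_core_iff H (by omega) ω).1 (h m hm)
    · exact Or.inr fun m hm hmL => (cycE_mem_core_iff H hmL ω).1 (h m hm hmL)
  · rintro (h | h)
    · exact Or.inl fun m hm => (cycE_mem_core_iff H (by omega) ω).2 (h m hm)
    · exact Or.inr fun m hm hmL => (cycE_mem_core_iff H hmL ω).2 (h m hm hmL)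

/-- Cycle edges are distinct (`L ≥ 3`). [this work] -/
theorem cycE_inj {i i' : ℕ} (hi : i < L) (hi' : i' < L) (h : cycE L cyc i = cycE L cyc i') : i = i' := by
  have hL := H.hL
  have h' : s(cyc i, cyc ((i + 1) % L)) = cycE L cyc i' := h
  rcases cycE_eq_iff L cyc H.hL H.hcyc hi (Nat.mod_lt _ (by omega)) hi' h' with ⟨h1, -⟩ | ⟨h1, h2⟩
  · exact h1
  · exfalso
    by_cases hlt : i' + 1 < L
    · rw [Nat.mod_eq_of_lt hlt] at h1
      subst h1
      by_cases hlt2 : i' + 1 + 1 < L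
      · rw [Nat.mod_eq_of_lt hlt2] at h2; omega
      · have : i' + 1 + 1 = L := by omega
        rw [this, Nat.mod_self] at h2; omega
    · have h3 : i' + 1 = L := by omega
      rw [h3, Nat.mod_self] at h1
      subst h1
      rw [Nat.mod_eq_of_lt (by omega : 0 + 1 < L)] at h2
      omega

/-! ## The exceptional pairs and almost-sure goodness -/

/-- The EXCEPTIONAL PAIRS of the block: non-loop pairs meeting `Z` that are neither cycle edges nor hub pairs. [this work] -/
def cycleForb (L : ℕ) (cyc : ℕ → Fin n) (S : ℕ → Finset (Fin n)) (Z : Finset (Fin n)) : Finset (Sym2 (Fin n)) :=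
  Finset.univ.filter fun e => ¬ e.IsDiag ∧ (∃ z ∈ Z, z ∈ e) ∧ (¬ ∃ i, i < L ∧ e = cycE L cyc i) ∧
    ¬ ∃ j, 1 ≤ j ∧ j < L ∧ e ∈ hubPairs (S j) (cyc j)

/-- GOOD configurations of the block: good for `Z` at `c`, good for every hub, and every open core pair is a cycle edge. [this work] -/
def CycleGood (L : ℕ) (cyc : ℕ → Fin n) (S : ℕ → Finset (Fin n)) (Z : Finset (Fin n)) (ω : BondConfig (Fin n)) : Prop :=
  Good (cyc 0) Z ω ∧ (∀ j, 1 ≤ j → j < L → Good (cyc j) (S j) ω) ∧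
    Carried L cyc 0 (fun _ => 0) (fun _ => cyc 0) (core Z (hubs (cpos L) S) ω)

/-- A hub pair of `S j` has all its vertices in `Z`. [this work] -/
theorem mem_Z_of_hubPair {j : ℕ} (hj1 : 1 ≤ j) (hjL : j < L) {e : Sym2 (Fin n)} (he : e ∈ hubPairs (S j) (cyc j)) {y : Fin n}
    (hy : y ∈ e) : y ∈ Z := by
  obtain ⟨-, hin⟩ := (Finset.mem_filter.1 he).2
  rcases hin y hy with h | h
  · exact H.SZ j hj1 hjL h
  · exact h ▸ H.cycZ j hj1 hjL

/-- **Every exceptional pair carries weight `0`.** [this work] -/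
theorem cycleForb_vanish {w : Sym2 (Fin n) → unitInterval} (hw : CycleHang L cyc S Z w) :
    ∀ e ∈ cycleForb L cyc S Z, (w e : ℝ) = 0 := by
  have hL := H.hL
  intro e he
  obtain ⟨hdiag, ⟨z, hz, hze⟩, hncyc, hnhub⟩ := (Finset.mem_filter.1 he).2
  -- write `e = s(z, y)` with `z ∈ Z`, `y ≠ z`
  induction e using Sym2.ind with
  | h a b =>
    -- reduce to the case where the first vertex lies in `Z`
    have key : ∀ x y : Fin n, x ≠ y → x ∈ Z → (¬ ∃ i, i < L ∧ s(x, y) = cycE L cyc i) →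
        (¬ ∃ j, 1 ≤ j ∧ j < L ∧ s(x, y) ∈ hubPairs (S j) (cyc j)) → (w s(x, y) : ℝ) = 0 := by
      intro x y hxy hx hnc hnh
      obtain ⟨j, hj1, hjL, hxj⟩ := H.Zsub x hx
      rcases hxj with rfl | hxS
      · -- `x = cyc j` a cycle vertex
        by_cases hyZ : y ∈ Z
        · obtain ⟨i, hi1, hiL, hyi⟩ := H.Zsub y hyZ
          rcases hyi with rfl | hyS
          · -- a chord
            have hij : j ≠ i := fun h => hxy (by rw [h])
            refine hw.chord j i hjL hiL hij (fun h => hnc ⟨j, hjL, ?_⟩) (fun h => hnc ⟨i, hiL, ?_⟩)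
            · unfold cycE; rw [h]
            · unfold cycE; rw [h, Sym2.eq_swap]
          · -- `y` in the hub `S i`
            by_cases hij : i = j
            · subst hij
              exact absurd ⟨i, hi1, hiL, Finset.mem_filter.2 ⟨Finset.mem_univ _, ⟨y, hyS, Sym2.mem_mk_right _ _⟩,
                fun z hz => by rcases Sym2.mem_iff.1 hz with rfl | rfl; exacts [Or.inr rfl, Or.inl hyS]⟩⟩ hnh
            · rw [Sym2.eq_swap]
              exact hw.hangS i hi1 hiL y (cyc j) (Ne.symm hxy) hyS (H.cycS j i hjL hi1 hiL) (fun h => hij (H.hcyc _ _ hiL hjL h.symm))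
        · by_cases hyc : y = cyc 0
          · subst hyc
            have hj0 : j ≠ 0 := by omega
            refine hw.chord j 0 hjL (by omega) hj0 (fun h => hnc ⟨j, hjL, ?_⟩) (fun h => hnc ⟨0, by omega, ?_⟩)
            · unfold cycE; rw [h]
            · unfold cycE; rw [h, Sym2.eq_swap]
          · exact hw.hangZ (cyc j) y hxy hx hyZ hyc
      · -- `x` in the hub `S j`
        by_cases hyS : y ∈ S j
        · exact absurd ⟨j, hj1, hjL, Finset.mem_filter.2 ⟨Finset.mem_univ _, ⟨x, hxS, Sym2.mem_mk_left _ _⟩,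
            fun z hz => by rcases Sym2.mem_iff.1 hz with rfl | rfl; exacts [Or.inl hxS, Or.inl hyS]⟩⟩ hnh
        · by_cases hyc : y = cyc j
          · subst hyc
            exact absurd ⟨j, hj1, hjL, Finset.mem_filter.2 ⟨Finset.mem_univ _, ⟨x, hxS, Sym2.mem_mk_left _ _⟩,
              fun z hz => by rcases Sym2.mem_iff.1 hz with rfl | rfl; exacts [Or.inl hxS, Or.inr rfl]⟩⟩ hnh
          · exact hw.hangS j hj1 hjL x y hxy hxS hyS hyc
    have hab : a ≠ b := fun h => hdiag (by rw [h]; exact Sym2.mk_isDiag_iff.2 rfl)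
    rcases Sym2.mem_iff.1 hze with rfl | rfl
    · exact key z b hab hz hncyc hnhub
    · rw [Sym2.eq_swap]
      rw [Sym2.eq_swap] at hncyc hnhub
      exact key z a (Ne.symm hab) hz hncyc hnhub

/-- **Off the exceptional pairs the configuration is good.** [this work] -/
theorem cycleGood_of_forb {ω : BondConfig (Fin n)} (hω : ∀ e ∈ cycleForb L cyc S Z, e ∉ ω) : CycleGood L cyc S Z ω := by
  have hL := H.hL
  -- membership in `cycleForb`
  have forb : ∀ x y : Fin n, x ≠ y → (x ∈ Z ∨ y ∈ Z) → (¬ ∃ i, i < L ∧ s(x, y) = cycE L cyc i) →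
      (¬ ∃ j, 1 ≤ j ∧ j < L ∧ s(x, y) ∈ hubPairs (S j) (cyc j)) → s(x, y) ∉ ω := by
    intro x y hxy hxZ hnc hnh
    refine hω _ (Finset.mem_filter.2 ⟨Finset.mem_univ _, ?_, ?_, hnc, hnh⟩)
    · rw [Sym2.mk_isDiag_iff]; exact hxy
    · rcases hxZ with h | h
      · exact ⟨x, h, Sym2.mem_mk_left _ _⟩
      · exact ⟨y, h, Sym2.mem_mk_right _ _⟩
  refine ⟨?_, ?_, ?_⟩
  · -- good for `Z` at `c`
    intro x y hxy he hx hy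
    by_contra hyc
    refine forb x y hxy (Or.inl hx) ?_ ?_ he
    · rintro ⟨i, hi, h⟩
      obtain ⟨i', hi', hyi⟩ := mem_cycE H hi (h ▸ Sym2.mem_mk_right x y : y ∈ cycE L cyc i)
      by_cases h0 : i' = 0
      · exact hyc (by rw [hyi, h0])
      · exact hy (hyi ▸ H.cycZ i' (Nat.one_le_iff_ne_zero.2 h0) hi')
    · rintro ⟨j, hj1, hjL, h⟩
      exact hy (mem_Z_of_hubPair H hj1 hjL h (Sym2.mem_mk_right x y))
  · -- good for every hub
    intro j hj1 hjL x y hxy he hx hy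
    by_contra hyc
    refine forb x y hxy (Or.inl (H.SZ j hj1 hjL hx)) ?_ ?_ he
    · rintro ⟨i, hi, h⟩
      obtain ⟨i', hi', hxi⟩ := mem_cycE H hi (h ▸ Sym2.mem_mk_left x y : x ∈ cycE L cyc i)
      exact H.cycS i' j hi' hj1 hjL (hxi ▸ hx)
    · rintro ⟨i, hi1, hiL, h⟩
      obtain ⟨-, hin⟩ := (Finset.mem_filter.1 h).2
      have hxi : x ∈ S i := by
        rcases hin x (Sym2.mem_mk_left x y) with h' | h'
        · exact h'
        · exact absurd (h' ▸ hx) (H.cycS i j hiL hj1 hjL)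
      have hij : i = j := by
        by_contra hij
        exact Finset.disjoint_left.1 (H.disj i j hi1 hiL hj1 hjL hij) hxi hx
      subst hij
      rcases hin y (Sym2.mem_mk_right x y) with h' | h'
      · exact hy h'
      · exact hyc h'
  · -- the open core pairs are cycle edges
    intro u v huv he
    obtain ⟨heω, hz, havoid⟩ := he
    by_contra hnot
    rw [not_or] at hnot
    refine forb u v huv ?_ hnot.1 ?_ heω
    · obtain ⟨z, hz, hze⟩ := hz
      rcases Sym2.mem_iff.1 hze with rfl | rfl
      · exact Or.inl hz
      · exact Or.inr hz
    · rintro ⟨j, hj1, hjL, h⟩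
      obtain ⟨⟨z, hzS, hze⟩, -⟩ := (Finset.mem_filter.1 h).2
      exact havoid z (mem_hubs.2 ⟨j, mem_cpos.2 ⟨hj1, hjL⟩, hzS⟩) hze

/-- **Almost surely the configuration is good**: events agreeing on good configurations have the same probability. [this work] -/
theorem real_congr_cycle {w : Sym2 (Fin n) → unitInterval} (hw : CycleHang L cyc S Z w) (U T : Set (BondConfig (Fin n)))
    (hUT : ∀ ω, CycleGood L cyc S Z ω → (ω ∈ U ↔ ω ∈ T)) : (prodBernoulli w).real U = (prodBernoulli w).real T :=
  real_congr_of_vanish w (cycleForb L cyc S Z) (cycleForb_vanish H hw) U T fun _ hω => hUT _ (cycleGood_of_forb H hω)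

/-! ## The arc reading of the block count -/

/-- **`c ↔ cyc j` through the core iff an arc to `cyc j` is open** (good configurations, `j < L`). [this work] -/
theorem coreReach_iff_RC {ω : BondConfig (Fin n)} (hω : CycleGood L cyc S Z ω) {j : ℕ} (hj : j < L) :
    core Z (hubs (cpos L) S) ω ∈ openConn (cyc 0) (cyc j) ↔ RC L cyc ω j := by
  rw [mem_openConn_cyc_iff L cyc 0 (fun _ => 0) (fun _ => cyc 0) H.hL H.hcyc (fun k hk => absurd hk (Nat.not_lt_zero k))
    (fun k _ hk => absurd hk (Nat.not_lt_zero k)) (fun k _ hk => absurd hk (Nat.not_lt_zero k)) _ hω.2.2 hj]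
  exact RC_core_iff H hj.le ω

/-- **The arc reading of the block count**: on a good configuration `#{a ∈ A ∩ Z : c ↔ a on Z} = arcCount … ω`. [this work] -/
theorem card_on_eq_arcCount {ω : BondConfig (Fin n)} (hω : CycleGood L cyc S Z ω) (A : Finset (Fin n)) :
    ((A ∩ Z).filter fun a => onZ Z ω ∈ openConn (cyc 0) a).card = arcCount L cyc S A ω := by
  have hgood : ∀ i ∈ cpos L, Good (cyc i) (S i) ω := fun i hi => hω.2.1 i (mem_cpos.1 hi).1 (mem_cpos.1 hi).2
  rw [card_on_eq_family (isHubFamily H) hgood (fun a ha => by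
    obtain ⟨j, hj1, hjL, h⟩ := H.Zsub a (Finset.mem_inter.1 ha).2
    exact ⟨j, mem_cpos.2 ⟨hj1, hjL⟩, h⟩)]
  unfold arcCount hubCount
  refine Finset.sum_congr rfl fun j hj => ?_
  rw [coreReach_iff_RC H hω (mem_cpos.1 hj).2]

/-- **Events read off the block count have the probability of the same events read off the arc count.** [this work] -/
theorem real_card_on_eq_arcCount {w : Sym2 (Fin n) → unitInterval} (hw : CycleHang L cyc S Z w) (A : Finset (Fin n)) (P : ℕ → Prop) :
    (prodBernoulli w).real {ω | P (((A ∩ Z).filter fun a => onZ Z ω ∈ openConn (cyc 0) a).card)} =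
      (prodBernoulli w).real {ω | P (arcCount L cyc S A ω)} :=
  real_congr_cycle H hw _ _ fun ω hω => by simp only [mem_setOf_eq, card_on_eq_arcCount H hω A]

/-- The internal marginal of the anchor `cyc j`: `P_w(c ↔ cyc j on Z) = P_w(RC j)`. [this work] -/
theorem real_onReach_cyc_eq {w : Sym2 (Fin n) → unitInterval} (hw : CycleHang L cyc S Z w) {j : ℕ} (hjL : j < L) :
    (prodBernoulli w).real {ω | onZ Z ω ∈ openConn (cyc 0) (cyc j)} = (prodBernoulli w).real {ω | RC L cyc ω j} :=
  real_congr_cycle H hw _ _ fun ω hω => by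
    simp only [mem_setOf_eq]
    have hgood : ∀ i ∈ cpos L, Good (cyc i) (S i) ω := fun i hi => hω.2.1 i (mem_cpos.1 hi).1 (mem_cpos.1 hi).2
    rw [show (onZ Z ω ∈ openConn (cyc 0) (cyc j)) = (openGraph (onZ Z ω)).Reachable (cyc 0) (cyc j) from rfl,
      on_reach_iff_core_family (isHubFamily H) hgood (fun i hi => H.cycS j i hjL (mem_cpos.1 hi).1 (mem_cpos.1 hi).2)]
    exact coreReach_iff_RC H hω hjL

/-- The core marginal of the anchor `cyc j`: `P_w(c ↔ cyc j in core) = P_w(RC j)`. [this work] -/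
theorem real_coreReach_cyc_eq {w : Sym2 (Fin n) → unitInterval} (hw : CycleHang L cyc S Z w) {j : ℕ} (hjL : j < L) :
    (prodBernoulli w).real {ω | core Z (hubs (cpos L) S) ω ∈ openConn (cyc 0) (cyc j)} = (prodBernoulli w).real {ω | RC L cyc ω j} :=
  real_congr_cycle H hw _ _ fun ω hω => by simp only [mem_setOf_eq]; exact coreReach_iff_RC H hω hjL

/-- The internal marginal of a hub vertex `a ∈ S j`: `P_w(c ↔ a on Z) = P_w(RC j ∧ cyc j ↔ a inside)`. [this work] -/
theorem real_onReach_hub_eq {w : Sym2 (Fin n) → unitInterval} (hw : CycleHang L cyc S Z w) {j : ℕ} (hj1 : 1 ≤ j) (hjL : j < L)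
    {a : Fin n} (ha : a ∈ S j) :
    (prodBernoulli w).real {ω | onZ Z ω ∈ openConn (cyc 0) a} =
      (prodBernoulli w).real ({ω | RC L cyc ω j} ∩ {ω | inS (S j) (cyc j) ω ∈ openConn (cyc j) a}) :=
  real_congr_cycle H hw _ _ fun ω hω => by
    simp only [mem_setOf_eq, Set.mem_inter_iff]
    have hgood : ∀ i ∈ cpos L, Good (cyc i) (S i) ω := fun i hi => hω.2.1 i (mem_cpos.1 hi).1 (mem_cpos.1 hi).2
    rw [show (onZ Z ω ∈ openConn (cyc 0) a) = (openGraph (onZ Z ω)).Reachable (cyc 0) a from rfl,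
      on_reach_hub_iff_family (isHubFamily H) hgood (mem_cpos.2 ⟨hj1, hjL⟩) ha]
    exact and_congr (coreReach_iff_RC H hω hjL) Iff.rfl

end CycleBlock

end Block

end Quant

end Summit.CriticalPhenomena.PercolationContinuityZ3.Theorems
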